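import Mathlib.NumberTheory.NumberField.Cyclotomic.Basic
import Mathlib.NumberTheory.NumberField.Cyclotomic.Embeddings
import Literature.NumberTheory.GaloisRepresentations.CubicReciprocityRationalPrime
import Summits.BirchSwinnertonDyer.Rank1Residual.Additive.X3RankZeroSemistableTwistOdd
import Summits.BirchSwinnertonDyer.Rank1Residual.Additive.MinusPeriodRatio
import Literature.NumberTheory.EllipticCurves.Wuthrich2014.DivisibilityChainProofs
import Literature.NumberTheory.EllipticCurves.Milne1972.WeilRestrictionQuadraticBSDQuotientAnyModel
import Literature.NumberTheory.EllipticCurves.BSDQuadraticDescentPeriodEliminationProofs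
import Literature.NumberTheory.EllipticCurves.ComplexMultiplicationBurungaleFlachFiniteProofs
import Literature.NumberTheory.EllipticCurves.TamagawaSubgroupProofs
import Literature.NumberTheory.EllipticCurves.TamagawaFiniteIndexProofs
import HarnessLib


/-!
# Line V14 (cell `b2b-bsdres`, seat additive-p4): the `K = ℚ(ζ₃)`-side tools — `C(V⊗K)` vs `∏c(V_K)`
# `3`-adically, finiteness of `V(K)`, and Milne's identity as an identity of rationals on `V ⊗ K`

HONEST FRAMING (cell `b2b-bsdres`, run/shared/lean/b2b/bsd-rank1-residual/, verbatim in every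
file): the goal of the cell is to DELETE the COMBINATION-SHAPED residual classes of the
Birch–Swinnerton-Dyer formula for ALL analytic-rank `≤ 1` elliptic curves over `ℚ` — "full BSD
formula for every rank `≤ 1` curve in class `C`" assembled STRICTLY from published theorems — so
that the rank-`≤ 1` remainder becomes exactly the CONSTRUCTION-SHAPED classes, which are TYPED
(missing-input `Prop`s), NOT attempted. This is not "finishing BSD". The additive sub-cell (seats
additive-p1…p4) is a RESEARCH ROUTE on the construction-shaped classes X3/X4; no claim beyond the
stated classes; the labels of X3 (and of X1, the class of the twist pairs) are UNCHANGED by this file;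
nothing is booked here (booking is the referee's call).

Theorems only (no `def`, no `sorry`, no new named fact). This file holds the three `K`-side lemmas
used by `X3RankZeroCyclotomicThree.lean` (the core theorem of line V14 — see its docstring for the
mathematics): §0 `[ℚ(ζ₃):ℚ] = 2`, `d = −3`, totally complex (Mathlib); §1 for a globally minimal
`V/ℚ` with good reduction at `p`, Dokchitser–Dokchitser's `C(V ⊗ K) = ∏_w c_w |ω/ω°_w|_w` of the
canonical model `V ⊗ K` has the same `p`-adic valuation as the Tamagawa product `∏_w c_w(V_K)` (the
model is minimal with good reduction above `p` — tree `localTamagawaFactor_baseChange_int_eq_one` —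
and `|ω/ω°_w|_w` is a power of `N(w) = ℓ^f`, `ℓ ≠ p`, elsewhere); §2 for `[K:ℚ] = 2`: `V(K)` is finite
when `V(ℚ)` and `V^{(d_K)}(ℚ)` are (tree, Silverman Ex. 10.16), and Milne's Weil-restriction identity
for the model `V ⊗ K` (Literature fact `Milne1972.bsdQuotient_baseChange_quadratic_anyModel`, taken
as the hypothesis `hWR`) becomes, after eliminating the periods with the tree's archimedean
comparison `Ω(V)·Ω(V^{(d_K)}) = n_V·Ω(V_K/K)`, the identity of rationals
`C(V⊗K)·#Ш(V_K)·#V(ℚ)²·#W(ℚ)² = n_V·|u_C|·#Ш(V)·#Ш(W)·∏c(V)·∏c(W)·#V(K)²` (same algebra as the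
tree's `bsdQuotient_baseChange_quadratic_eq_iff`, which is stated for a MINIMAL `K`-model; here no
minimal `K`-model is needed).
-/

noncomputable section

open scoped Classical MatrixGroups ModularForm

open CongruenceSubgroup WeierstrassCurve NumberField IsDedekindDomain
  Literature.NumberTheory.EllipticCurves Literature.NumberTheory.EllipticCurves.ModularForms
  Literature.NumberTheory.EllipticCurves.Rank1Residual
  Literature.NumberTheory.EllipticCurves.Rank1Residual.Typed
  Literature.NumberTheory.GaloisRepresentations

namespace Summit.BirchSwinnertonDyer.Rank1Residual.Additive

/-! ## §0 The field `K = ℚ(ζ₃)` -/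

section FieldK

variable (K : Type) [Field K] [NumberField K] [IsCyclotomicExtension {3} ℚ K]

/-- `d_{ℚ(ζ₃)} = −3`. [folklore] -/
theorem discr_cyclotomicThree : NumberField.discr K = -3 := by
  have h := IsCyclotomicExtension.Rat.discr_prime 3 K
  norm_num at h
  exact h

/-- `ℚ(ζ₃)` is totally complex. [folklore] -/
theorem isTotallyComplex_cyclotomicThree : IsTotallyComplex K :=
  IsCyclotomicExtension.Rat.isTotallyComplex (n := 3) K (by norm_num)

end FieldK

/-! ## §1 The canonical `K`-model `V ⊗ K`: Dokchitser–Dokchitser's `C(V_K)` vs. the Tamagawa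
product, `p`-adically, at a prime `p` of good reduction of `V` -/

section Tamagawa

variable {K : Type} [Field K] [NumberField K]
  (V : WeierstrassCurve ℚ) [V.IsElliptic] [V.IsGloballyMinimal] (p : ℕ) [hp : Fact p.Prime]

omit [V.IsElliptic] in
/-- `(integralModelInt V) ⊗ K = V ⊗ K` (the `ℤ`-model and the `ℚ`-model have the same base change).
[folklore] -/
theorem baseChange_integralModelInt_eq :
    (integralModelInt V).baseChange K = V.baseChange K := by
  conv_rhs => rw [← map_integralModelInt V]
  rw [baseChange, baseChange, map_map]
  congr 1
  exact Subsingleton.elim _ _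

/-- **At a place `w` of `K` above the good prime `p`, the model `V ⊗ K` is minimal with good
reduction: `c_w(V_K) = 1` and `C_w(V ⊗ K) = 1`.** (`p ∤ Δ_min(V)`; the tree's
`localTamagawaFactor_baseChange_int_eq_one` and its ingredients, Silverman VII.5.1(a), VII.2.)
[cite: SilvermanAEC2009, VII.5 Prop. 5.1(a) and VII.2 (remark after Prop. 2.1)] -/
theorem localTamagawaNumber_baseChange_eq_one_of_mem (hΔ : ¬ (p : ℤ) ∣ minimalDiscriminantInt V)
    (w : HeightOneSpectrum (𝓞 K)) (hpw : (p : 𝓞 K) ∈ w.asIdeal) :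
    ((V.baseChange K).baseChange (w.adicCompletion K)).localTamagawaNumber
        (w.adicCompletionIntegers K) = 1 ∧
      (V.baseChange K).localTamagawaFactor w = 1 := by
  have hΔ0 : (integralModelInt V).Δ ≠ 0 := minimalDiscriminantInt_ne_zero V
  have hfac := localTamagawaFactor_baseChange_int_eq_one (L := K) (integralModelInt V) hΔ0 w hp.out
    hpw hΔ
  rw [baseChange_integralModelInt_eq] at hfac
  refine ⟨?_, hfac⟩
  -- `c_w = 1`: unit discriminant ⇒ minimal at `w` with `ord_w Δ_min = 0` ⇒ good reduction
  have hval : w.valuation K (V.baseChange K).Δ = 1 := by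
    rw [← baseChange_integralModelInt_eq]
    exact valuation_Δ_baseChange_int_eq_one (integralModelInt V) w hp.out hpw hΔ
  have hint : (V.baseChange K).IsIntegralAt w := by
    rw [← baseChange_integralModelInt_eq]
    exact isIntegralAt_baseChange_intModel (integralModelInt V) w
  have hmin : (V.baseChange K).IsMinimalAt w := by
    refine isMinimalAt_of_lt_valuation_Δ_holds hint ?_
    rw [hval, ← WithZero.exp_zero, WithZero.exp_lt_exp]
    norm_num
  have hord : (V.baseChange K).ordMinimalDiscriminant w = 0 := by
    have h := valuation_Δ_eq_of_isMinimalAt_holds (v := w) (W := V.baseChange K) hmin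
    rw [hval, eq_comm, WithZero.exp_eq_one] at h
    omega
  have hgood : (V.baseChange K).HasGoodReductionAt w :=
    (ordMinimalDiscriminant_eq_zero_iff_holds w (V.baseChange K)).mp hord
  haveI : (((V.baseChange K).baseChange (w.adicCompletion K)).minimal
      (w.adicCompletionIntegers K)).HasGoodReduction (w.adicCompletionIntegers K) := hgood
  exact localTamagawaNumber_eq_one_of_hasGoodReduction_holds _ _

/-- **`ord_p C_w(V ⊗ K) = ord_p c_w(V_K)` at EVERY finite place `w`** when `p` is a good prime of `V`:
above `p` both are `0` (previous lemma); away from `p`, `C_w = c_w · N(w)^{k_w}` with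
`N(w) = ℓ^{f_w}`, `ℓ ≠ p`. [cite: DokchitserDokchitserAnnals2010, §1 Notation (arXiv pp. 4–5)] -/
theorem padicValRat_localTamagawaFactor_baseChange (hΔ : ¬ (p : ℤ) ∣ minimalDiscriminantInt V)
    (w : HeightOneSpectrum (𝓞 K)) :
    padicValRat p ((V.baseChange K).localTamagawaFactor w) =
      padicValNat p (((V.baseChange K).baseChange (w.adicCompletion K)).localTamagawaNumber
        (w.adicCompletionIntegers K)) := by
  obtain ⟨ℓ, hℓ, hℓw⟩ : ∃ ℓ : ℕ, ℓ.Prime ∧ (ℓ : 𝓞 K) ∈ w.asIdeal :=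
    ⟨_, Nat.absNorm_under_prime w.asIdeal, Int.absNorm_under_mem w.asIdeal⟩
  by_cases hℓp : ℓ = p
  · subst hℓp
    obtain ⟨hc, hfac⟩ := localTamagawaNumber_baseChange_eq_one_of_mem V ℓ hΔ w hℓw
    rw [hc, hfac, padicValRat.one, padicValNat_one_right, Nat.cast_zero]
  · -- `N(w) = ℓ^f` with `ℓ ≠ p`
    haveI : w.asIdeal.LiesOver (Ideal.span {(ℓ : ℤ)}) := Ideal.liesOver_span_of_natCast_mem' hℓ hℓw
    have hN : Ideal.absNorm w.asIdeal = ℓ ^ ((Ideal.span {(ℓ : ℤ)}).inertiaDeg' w.asIdeal) :=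
      Ideal.absNorm_eq_pow_inertiaDeg' w.asIdeal hℓ
    have hc0 : (((V.baseChange K).baseChange (w.adicCompletion K)).localTamagawaNumber
        (w.adicCompletionIntegers K) : ℚ) ≠ 0 := by
      exact_mod_cast (V.baseChange K).localTamagawaNumber_baseChange_ne_zero w
    have hN0 : ((Ideal.absNorm w.asIdeal : ℕ) : ℚ) ≠ 0 := by
      rw [hN]; exact_mod_cast pow_ne_zero _ hℓ.ne_zero
    have hvN : padicValRat p ((Ideal.absNorm w.asIdeal : ℕ) : ℚ) = 0 := by
      haveI : Fact ℓ.Prime := ⟨hℓ⟩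
      rw [hN, padicValRat.of_nat, Nat.cast_eq_zero, padicValNat.pow,
        padicValNat_primes (Ne.symm hℓp), mul_zero]
    rw [localTamagawaFactor_def, padicValRat.mul hc0 (zpow_ne_zero _ hN0), padicValRat.zpow, hvN,
      mul_zero, add_zero, padicValRat.of_nat]

/-- **`ord_p C(V ⊗ K) = ord_p ∏_w c_w(V_K)`** for the canonical model `V ⊗ K` of a globally minimal
`V/ℚ` with good reduction at `p`: Dokchitser–Dokchitser's modified Tamagawa product of the model
`V ⊗ K` (whose differential is Néron at every `w ∤ p`-adically-irrelevant place and at the places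
above `p`) has the same `p`-adic valuation as the Tamagawa product of `V_K`.
[cite: DokchitserDokchitserAnnals2010, §1 Notation (arXiv pp. 4–5)] -/
theorem padicValRat_modifiedTamagawaProduct_baseChange (hΔ : ¬ (p : ℤ) ∣ minimalDiscriminantInt V) :
    padicValRat p (V.baseChange K).modifiedTamagawaProduct =
      padicValNat p (V.baseChange K).tamagawaProduct := by
  set VK := V.baseChange K with hVK
  set c : HeightOneSpectrum (𝓞 K) → ℕ := fun w ↦
    (VK.baseChange (w.adicCompletion K)).localTamagawaNumber (w.adicCompletionIntegers K) with hc
  set C : HeightOneSpectrum (𝓞 K) → ℚ := fun w ↦ VK.localTamagawaFactor w with hC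
  -- finite supports
  have hfin_c : (Function.mulSupport c).Finite := VK.mulSupport_localTamagawaNumber_finite_holds
  have hΔ0 : (integralModelInt V).Δ ≠ 0 := minimalDiscriminantInt_ne_zero V
  have hfin_C : (Function.mulSupport C).Finite := by
    have hI : (Ideal.span {((integralModelInt V).Δ : 𝓞 K)} : Ideal (𝓞 K)) ≠ 0 := by
      rw [Ne, Ideal.zero_eq_bot, Ideal.span_singleton_eq_bot]
      exact_mod_cast hΔ0
    refine (Ideal.finite_factors hI).subset fun w hw ↦ ?_
    rw [Function.mem_mulSupport] at hw
    rw [Set.mem_setOf_eq, Ideal.dvd_span_singleton]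
    by_contra hnot
    apply hw
    obtain ⟨ℓ, hℓ, hℓw⟩ : ∃ ℓ : ℕ, ℓ.Prime ∧ (ℓ : 𝓞 K) ∈ w.asIdeal :=
      ⟨_, Nat.absNorm_under_prime w.asIdeal, Int.absNorm_under_mem w.asIdeal⟩
    have hd : ¬ (ℓ : ℤ) ∣ (integralModelInt V).Δ := by
      rintro ⟨m, hm⟩
      apply hnot
      have : ((integralModelInt V).Δ : 𝓞 K) = (ℓ : 𝓞 K) * (m : 𝓞 K) := by
        rw [hm]; push_cast; ring
      rw [this]
      exact Ideal.mul_mem_right _ _ hℓw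
    have h1 := localTamagawaFactor_baseChange_int_eq_one (L := K) (integralModelInt V) hΔ0 w hℓ hℓw hd
    rw [baseChange_integralModelInt_eq] at h1
    exact h1
  -- a common finite index set
  obtain ⟨s, hs_c, hs_C⟩ : ∃ s : Finset (HeightOneSpectrum (𝓞 K)),
      Function.mulSupport c ⊆ s ∧ Function.mulSupport C ⊆ s := by
    refine ⟨hfin_c.toFinset ∪ hfin_C.toFinset, ?_, ?_⟩
    · intro w hw
      simp only [Finset.coe_union, Set.Finite.coe_toFinset, Set.mem_union]
      exact Or.inl hw
    · intro w hw
      simp only [Finset.coe_union, Set.Finite.coe_toFinset, Set.mem_union]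
      exact Or.inr hw
  have hTam : VK.tamagawaProduct = ∏ w ∈ s, c w := by
    rw [WeierstrassCurve.tamagawaProduct]
    exact finprod_eq_prod_of_mulSupport_subset c hs_c
  have hMod : VK.modifiedTamagawaProduct = ∏ w ∈ s, C w := by
    rw [modifiedTamagawaProduct_def]
    exact finprod_eq_prod_of_mulSupport_subset C hs_C
  rw [hMod, hTam, ← padicValRat.of_nat, Nat.cast_prod]
  -- termwise
  have hterm : ∀ w, padicValRat p (C w) = padicValRat p ((c w : ℕ) : ℚ) := by
    intro w
    rw [padicValRat.of_nat]
    exact padicValRat_localTamagawaFactor_baseChange V p hΔ w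
  have hC0 : ∀ w, C w ≠ 0 := fun w ↦ by
    show VK.localTamagawaFactor w ≠ 0
    rw [localTamagawaFactor_def]
    refine mul_ne_zero ?_ (zpow_ne_zero _ ?_)
    · exact_mod_cast VK.localTamagawaNumber_baseChange_ne_zero w
    · have h : Ideal.absNorm w.asIdeal ≠ 0 := by
        rw [Ne, Ideal.absNorm_eq_zero_iff]
        exact w.ne_bot
      exact_mod_cast h
  have hc0 : ∀ w, ((c w : ℕ) : ℚ) ≠ 0 := fun w ↦ by
    exact_mod_cast VK.localTamagawaNumber_baseChange_ne_zero w
  -- valuation of a product = sum of valuations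
  have key : ∀ t : Finset (HeightOneSpectrum (𝓞 K)),
      padicValRat p (∏ w ∈ t, C w) = padicValRat p (∏ w ∈ t, ((c w : ℕ) : ℚ)) := by
    intro t
    induction t using Finset.induction_on with
    | empty => simp
    | insert a t hat ih =>
      rw [Finset.prod_insert hat, Finset.prod_insert hat,
        padicValRat.mul (hC0 a) (Finset.prod_ne_zero_iff.mpr fun w _ ↦ hC0 w),
        padicValRat.mul (hc0 a) (Finset.prod_ne_zero_iff.mpr fun w _ ↦ hc0 w), hterm a, ih]
  exact key s

end Tamagawa

/-! ## §2 Over a quadratic field: finiteness of `V(K)` and Milne's identity as an identity of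
rationals on the canonical model `V ⊗ K` -/

section OverQuadratic

variable (K : Type) [Field K] [NumberField K]
  (V : WeierstrassCurve ℚ) [V.IsElliptic] [V.IsGloballyMinimal]
  (W : WeierstrassCurve ℚ) [W.IsElliptic] [W.IsGloballyMinimal]

omit [V.IsGloballyMinimal] [W.IsElliptic] [W.IsGloballyMinimal] in
/-- **`V(K)` is finite when `V(ℚ)` and `W(ℚ) ≅ V^{(d_K)}(ℚ)` are** (`[K : ℚ] = 2`): the tree's
`finite_point_baseChange_of_finite_of_finite_quadraticTwist` (Silverman *AEC* Ex. 10.16) moved from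
`K = ℚ(θ)`, `θ² = c`, to the twist by `d_K = c q²`. [cite: SilvermanAEC2009, Exercise 10.16 and Cor. III.6.4] -/
theorem finite_point_baseChange_of_twist (h2 : Module.finrank ℚ K = 2)
    {C : VariableChange ℚ} (hC : C • V.quadraticTwist (NumberField.discr K : ℚ) = W)
    [hV : Finite V.toAffine.Point] [hW : Finite W.toAffine.Point] :
    Finite (V.baseChange K).toAffine.Point := by
  obtain ⟨θ, c, hθ, hc⟩ :=
    Literature.NumberTheory.QuadraticFields.Quadratic.exists_sq_eq_algebraMap (F := ℚ) (K := K) h2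
  obtain ⟨q, hq, hd⟩ := NumberField.exists_discr_eq_mul_sq h2 hθ hc
  obtain ⟨C₁, hC₁⟩ := V.exists_variableChange_quadraticTwist_mul_sq c q hq
  rw [← hd] at hC₁
  haveI : Finite (V.quadraticTwist (NumberField.discr K : ℚ)).toAffine.Point := by
    rw [← hC]  at hW
    exact Finite.of_equiv _ (VariableChange.pointEquiv _ C).toEquiv.symm
  haveI : Finite (V.quadraticTwist c).toAffine.Point := by
    rw [← hC₁] at this
    exact Finite.of_equiv _ (VariableChange.pointEquiv _ C₁).toEquiv.symm
  exact finite_point_baseChange_of_finite_of_finite_quadraticTwist V h2 hθ hc hV this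

omit [V.IsGloballyMinimal] [W.IsElliptic] [W.IsGloballyMinimal] in
/-- **Milne's Weil-restriction identity on the canonical model `V ⊗ K`, as an identity of RATIONALS**
(imaginary quadratic `K`, all Mordell–Weil groups finite). From the model-free form
`#Ш(V_K)·Reg·Ω(ω_V)·C(V⊗K)/#tors² = RHS(V)·RHS(W)` (`hWR`, Literature fact
`Milne1972.bsdQuotient_baseChange_quadratic_anyModel` for the model `V ⊗ K`), with `Reg = 1`,
`#tors = #V(K)` (finite), `RHS(E) = #Ш·Ω·∏c/#E(ℚ)²`, `Ω(W) = |u_C|·Ω(V^{(d_K)})` and the archimedean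
comparison `Ω(V)·Ω(V^{(d_K)}) = n_V·Ω(V_K/K)` (tree
`realPeriod_mul_realPeriod_quadraticTwist_eq_mul_bsdPeriod`), the positive period `Ω(V_K/K)` cancels:
`C(V⊗K)·#Ш(V_K)·#V(ℚ)²·#W(ℚ)² = n_V·|u_C|·#Ш(V)·#Ш(W)·∏c(V)·∏c(W)·#V(K)²`. Same algebra as the
tree's `bsdQuotient_baseChange_quadratic_eq_iff`, with `C(V⊗K)` in place of the Tamagawa product of
a minimal model (no minimal `K`-model is needed).
[cite: Milne1972ArithmeticAV, §1 Thm. 1 and §2 (through DokchitserDokchitserAnnals2010, §2.1, proof of Thm. 8)] -/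
theorem card_identity_baseChange [IsTotallyComplex K] (h2 : Module.finrank ℚ K = 2)
    {C : VariableChange ℚ} (hC : C • V.quadraticTwist (NumberField.discr K : ℚ) = W)
    [Finite V.toAffine.Point] [Finite W.toAffine.Point] [Finite (V.baseChange K).toAffine.Point]
    (hWR : ((V.baseChange K).shaOrder : ℝ) * (V.baseChange K).regulator * (V.baseChange K).bsdPeriod *
        ((V.baseChange K).modifiedTamagawaProduct : ℝ) / ((V.baseChange K).torsionOrder : ℝ) ^ 2 =
      V.bsdRHS * W.bsdRHS) :
    ((V.baseChange K).modifiedTamagawaProduct * (V.baseChange K).shaOrder *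
        (Nat.card V.toAffine.Point) ^ 2 * (Nat.card W.toAffine.Point) ^ 2 : ℚ) =
      (V.baseChange ℝ).numRealComponents * |(C.u : ℚ)| * V.shaOrder * W.shaOrder *
        V.tamagawaProduct * W.tamagawaProduct * (Nat.card (V.baseChange K).toAffine.Point) ^ 2 := by
  set VK := V.baseChange K with hVK
  set P : ℝ := VK.bsdPeriod with hP_def
  have hP : 0 < P := bsdPeriod_pos' _
  have hΩW : W.realPeriodRat = |((C.u : ℚ) : ℝ)| * (V.quadraticTwist (NumberField.discr K : ℚ)).realPeriodRat := by
    rw [← hC]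
    exact (V.quadraticTwist (NumberField.discr K : ℚ)).realPeriodRat_smul_holds C
  have hA : V.realPeriodRat * (V.quadraticTwist (NumberField.discr K : ℚ)).realPeriodRat =
      ((V.baseChange ℝ).numRealComponents : ℝ) * P :=
    realPeriod_mul_realPeriod_quadraticTwist_eq_mul_bsdPeriod V K h2
  rw [VK.regulator_eq_one_of_finite, VK.torsionOrder_eq_natCard_of_finite, V.bsdRHS_eq_of_finite,
    W.bsdRHS_eq_of_finite, hΩW, mul_one] at hWR
  have hNK : (Nat.card VK.toAffine.Point : ℝ) ≠ 0 := by
    exact_mod_cast (Nat.card_pos (α := VK.toAffine.Point)).ne'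
  have hNV : (Nat.card V.toAffine.Point : ℝ) ≠ 0 := by
    exact_mod_cast (Nat.card_pos (α := V.toAffine.Point)).ne'
  have hNW : (Nat.card W.toAffine.Point : ℝ) ≠ 0 := by
    exact_mod_cast (Nat.card_pos (α := W.toAffine.Point)).ne'
  -- clear denominators in `ℝ`
  have hWR' : (VK.shaOrder : ℝ) * P * (VK.modifiedTamagawaProduct : ℝ) *
        ((Nat.card V.toAffine.Point : ℝ) ^ 2 * (Nat.card W.toAffine.Point : ℝ) ^ 2) =
      (V.shaOrder : ℝ) * V.realPeriodRat * (V.tamagawaProduct : ℝ) *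
        ((W.shaOrder : ℝ) * (|((C.u : ℚ) : ℝ)| *
          (V.quadraticTwist (NumberField.discr K : ℚ)).realPeriodRat) * (W.tamagawaProduct : ℝ)) *
        (Nat.card VK.toAffine.Point : ℝ) ^ 2 := by
    have h := hWR
    field_simp at h
    linear_combination h
  have key : ((VK.modifiedTamagawaProduct : ℝ) * (VK.shaOrder : ℝ) *
        (Nat.card V.toAffine.Point : ℝ) ^ 2 * (Nat.card W.toAffine.Point : ℝ) ^ 2) * P =
      (((V.baseChange ℝ).numRealComponents : ℝ) * |((C.u : ℚ) : ℝ)| * (V.shaOrder : ℝ) *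
        (W.shaOrder : ℝ) * (V.tamagawaProduct : ℝ) * (W.tamagawaProduct : ℝ) *
        (Nat.card VK.toAffine.Point : ℝ) ^ 2) * P := by
    linear_combination hWR' + (|((C.u : ℚ) : ℝ)| * (V.shaOrder : ℝ) * (W.shaOrder : ℝ) *
      (V.tamagawaProduct : ℝ) * (W.tamagawaProduct : ℝ) * (Nat.card VK.toAffine.Point : ℝ) ^ 2) * hA
  have key' := mul_right_cancel₀ hP.ne' key
  exact_mod_cast key'

end OverQuadratic

end Summit.BirchSwinnertonDyer.Rank1Residual.Additive

end
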